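import Mathlib.NumberTheory.LSeries.Dirichlet
import Mathlib.NumberTheory.Harmonic.ZetaAsymp
import Mathlib.Analysis.Complex.RemovableSingularity
import Mathlib.Analysis.Complex.CauchyIntegral
import Mathlib.Analysis.SpecialFunctions.Pow.Deriv
import Mathlib.Analysis.MellinInversion
import Mathlib.Analysis.SpecialFunctions.Integrals.Basic
import Mathlib.Analysis.SpecialFunctions.ImproperIntegrals
import Mathlib.Analysis.SpecialFunctions.JapaneseBracket
import Literature.NumberTheory.LFunctions.LittlewoodCriterion
import Literature.NumberTheory.LFunctions.RHInvZetaBound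
import HarnessLib

/-!
# `RH ⇒ M(x) = O(x^{1/2+ε})` via a smoothed Perron formula (Titchmarsh Thm. 14.25 (A) ⇒ (C))

Topic: `Literature/NumberTheory/LFunctions`. Companion of `LittlewoodCriterion.lean` (the
partial-summation half (C) ⇒ RH of Littlewood's criterion, Titchmarsh, *The Theory of the Riemann
Zeta-Function*, 2nd ed. (1986), Thm. 14.25 (C), §14.25) and of the named fact
`Literature.NumberTheory.LFunctions.riemannHypothesis_iff_mertensFunction_isBigO` (`RHClassicalEquivalents.lean`, rh.S21).
This file proves the necessity half RH ⇒ `M(x) = O(x^{1/2+ε})` and assembles Littlewood's criterion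
as a theorem of the tree, `Literature.NumberTheory.LFunctions.riemannHypothesis_iff_mertensFunction_isBigO_holds` (discharge of
rh.S21). The one analytic input beyond Mathlib is Littlewood's bound `1/ζ(σ+it) = O(t^ε)`
(`σ > 1/2`, under RH; Titchmarsh Thm. 14.2, eq. (14.2.6)), used — as in the printed proof of
Thm. 14.25 (C) (§14.25) — uniformly on the horizontal segments `σ ∈ [1/2+δ, 2]`; it is PROVED in
`RHInvZetaBound.lean` (`Literature.NumberTheory.LFunctions.InvZetaRH.norm_inv_riemannZeta_le_rpow`, Borel–Carathéodory + Hadamard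
three circles), so no named fact is assumed here. (The tree also records (14.2.6) pointwise in `σ`,
`t → +∞`, as the named fact `Literature.NumberTheory.LFunctions.zeta_inv_isBigO_rpow_of_riemannHypothesis` of
`NymanBeurling.lean`; that fact is the pointwise weakening of `norm_inv_riemannZeta_le_rpow` and is
discharged from it in `RHInvZetaBoundDischarge.lean`.)

The printed proof (§14.25) applies the truncated Perron formula (Lemma 3.12) to `1/ζ(w) x^w/w` on
`[2-iT, 2+iT]`, moves the contour to `Re w = 1/2 + δ` (no poles under RH), bounds the three sides
by (14.2.6) and takes `T = x²`. We run the same contour shift with a *smoothed* Perron kernel,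
which makes every integral absolutely convergent and avoids the truncation error terms:

* `φ_h(u) = min(1, max(0, (1+h-u)/h))` (`1` on `[0,1]`, `0` after `1+h`, linear between) has
  Mellin transform `Φ_h(s) = ((1+h)^{s+1} − 1)/(h s (s+1))` (`mellin_phi`), with
  `‖Φ_h(s)‖ ≤ 8/‖s‖`, `‖Φ_h(s)‖ ≤ 9/(h‖s‖²)`, hence `‖Φ_h(s)‖ ≤ 9 h^{-2ε}‖s‖^{-1-2ε}`
  (`norm_Phi_le_rpow`), on `0 < Re s ≤ 2`, `0 < h ≤ 1`.
* Mellin inversion (Mathlib `mellinInv_mellin_eq`) and `1/ζ(s) = ∑ μ(n) n^{-s}` on `Re s = 2`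
  (Mathlib `LSeries_one_mul_Lseries_moebius`) give the smoothed Perron formula
  `∫ Φ_h(2+it) x^{2+it} ζ(2+it)^{-1} dt = 2π ∑ μ(n) φ_h(n/x)` (`integral_Fint_two`; the
  interchange of `∑` and `∫` is `integral_tsum_of_summable_integral_norm`).
* Under RH, `zetaInv = 1/ζ` (with the removable singularity at `s = 1` filled in) is holomorphic
  on `Re s > 1/2` (`differentiableOn_zetaInv`), and (14.2.6) (`RHInvZetaBound.lean`, `|t| ≥ T`)
  plus compactness (`|t| ≤ T`, `σ ≤ 2`) and `∑ n^{-2}` (`σ ≥ 2`) give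
  `‖zetaInv(σ+it)‖ ≤ K(1+|t|)^ε` uniformly on `σ ≥ 1/2 + ε'` (`exists_bound_zetaInv`); Cauchy's
  theorem on rectangles `[1/2+ε', 2] × [-T, T]` (Mathlib
  `integral_boundary_rect_eq_zero_of_differentiableOn`) with `T → ∞` shifts the line
  (`integral_vertical_eq_of_tendsto`, `integral_Fint_eq_two`).
* On `Re s = 1/2 + ε'` the integral is `O(x^{1/2+ε'} h^{-2ε'})` (`norm_integral_Fint_le`), and
  `|M(x) − ∑ μ(n)φ_h(n/x)| ≤ xh + 1` (`norm_mertens_sub_tsum_le`); `h = x^{-1/2}` gives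
  `M(x) = O(x^{1/2+2ε'})` (`mertens_isBigO_of_riemannHypothesis`).

## Contents

* `Literature.NumberTheory.LFunctions.MertensBoundRH.zetaInv`, its holomorphy on `Re s > 1/2` under RH, and
  `exists_bound_zetaInv` (uniform `‖zetaInv(σ+it)‖ ≤ K(1+|t|)^ε` on `σ ≥ σ₀ > 1/2`, from (14.2.6)).
* `Literature.NumberTheory.LFunctions.MertensBoundRH.phi`, `Phi`, `mellin_phi`, `mellinInv_Phi`, the `Φ_h` bounds.
* `Literature.NumberTheory.LFunctions.MertensBoundRH.integral_vertical_two_eq_tsum` — smoothed Perron formula on `Re s = 2`.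
* `Literature.NumberTheory.LFunctions.MertensBoundRH.integral_vertical_eq_of_tendsto` — shifting a vertical line of integration.
* `Literature.NumberTheory.LFunctions.MertensBoundRH.mertens_isBigO_of_riemannHypothesis`,
  `Literature.NumberTheory.LFunctions.mertensFunction_isBigO_of_riemannHypothesis` — RH ⇒ `M(x) = O(x^{1/2+ε})`
  (Thm. 14.25 (A) ⇒ (C)), proved outright.
* `Literature.NumberTheory.LFunctions.mertens_isBigO_of_quasiRiemannHypothesis_one_half` — the `θ = 1/2` case of the named fact
  `Literature.NumberTheory.LFunctions.mertens_isBigO_of_quasiRiemannHypothesis` (`QuasiRHFacts.lean`), proved outright.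
* `Literature.NumberTheory.LFunctions.riemannHypothesis_iff_mertensFunction_isBigO_holds` — **discharge of rh.S21**
  (`RHClassicalEquivalents.lean`): Littlewood's criterion `RH ↔ ∀ ε > 0, M(x) = O(x^{1/2+ε})`.

## Sources

* E. C. Titchmarsh, *The Theory of the Riemann Zeta-Function*, 2nd ed. revised by
  D. R. Heath-Brown, Oxford 1986: Thm. 14.25 (C) and its proof (§14.25; (14.2.6) is used there
  uniformly on the segments `1/2 + δ ≤ σ ≤ 2`, `|v| ≤ T`); Thm. 14.2 and (14.2.1)–(14.2.6)
  (§14.2); Lemma 3.12 (Perron's formula, §3.12).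
* J. E. Littlewood, *Quelques conséquences de l'hypothèse que la fonction ζ(s) n'a pas de zéros
  dans le demi-plan Re(s) > 1/2*, C. R. Acad. Sci. Paris 154 (1912), 263–266.
* H. L. Montgomery, R. C. Vaughan, *Multiplicative Number Theory I* (2007), §5.1 (smoothed Perron
  formulae via Mellin inversion), p. 338 (RH ⇒ `M(x) ≪ x^{1/2+ε}` by moving the contour).

## Design choices

* The smoothing replaces Titchmarsh's truncated Perron formula with error term `O(x²/T)`; the
  price is the extra parameter `h`, recovered by `h = x^{-1/2}` since the weights differ from the
  sharp cutoff only on `x < n ≤ x(1+h)` (at most `xh + 1` integers).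
* `zetaInv` is `Function.update (ζ⁻¹) 1 0`, so that the integrand is holomorphic on the whole
  half-plane `Re s > 1/2` and Cauchy's theorem applies to rectangles crossing `Im s = 0`.
-/

noncomputable section

open Complex Filter Topology Asymptotics MeasureTheory Set
open scoped Real

namespace Literature.NumberTheory.LFunctions

namespace MertensBoundRH

/-- `1/ζ(s)` with the removable singularity at the pole `s = 1` of `ζ` filled in by `0`.
[folklore] -/
def zetaInv : ℂ → ℂ := Function.update (fun s => (riemannZeta s)⁻¹) 1 0

/-- Off `s = 1`, `zetaInv s = ζ(s)⁻¹`. [folklore] -/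
lemma zetaInv_of_ne_one {s : ℂ} (hs : s ≠ 1) : zetaInv s = (riemannZeta s)⁻¹ := by
  simp [zetaInv, hs]

/-- `1/ζ(s) → 0` as `s → 1` (simple pole, Mathlib `riemannZeta_residue_one`). [folklore] -/
lemma tendsto_inv_riemannZeta_one : Tendsto (fun s => (riemannZeta s)⁻¹) (𝓝[≠] 1) (𝓝 0) := by
  have h1 : Tendsto (fun s : ℂ => s - 1) (𝓝[≠] 1) (𝓝 0) := by
    have : Tendsto (fun s : ℂ => s - 1) (𝓝 1) (𝓝 (1 - 1)) := tendsto_id.sub tendsto_const_nhds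
    rw [sub_self] at this
    exact this.mono_left nhdsWithin_le_nhds
  have h3 := h1.mul (riemannZeta_residue_one.inv₀ one_ne_zero)
  simp only [inv_one, zero_mul] at h3
  refine h3.congr' ?_
  filter_upwards [self_mem_nhdsWithin] with s hs
  rw [mul_inv, ← mul_assoc, mul_inv_cancel₀ (sub_ne_zero.mpr hs), one_mul]

/-- `zetaInv` is continuous at the filled-in point `s = 1`. [folklore] -/
lemma continuousAt_zetaInv_one : ContinuousAt zetaInv 1 := by
  rw [zetaInv, continuousAt_update_same]
  exact tendsto_inv_riemannZeta_one

/-- Under RH, `zetaInv` is differentiable at every `s ≠ 1` with `Re s > 1/2`. [folklore] -/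
lemma differentiableAt_zetaInv_of_ne_one (hRH : RiemannHypothesis) {s : ℂ} (hs : 1 / 2 < s.re)
    (h1 : s ≠ 1) : DifferentiableAt ℂ zetaInv s := by
  have heq : zetaInv =ᶠ[𝓝 s] fun z => (riemannZeta z)⁻¹ := by
    filter_upwards [isOpen_compl_singleton.mem_nhds h1] with z hz
    exact zetaInv_of_ne_one hz
  refine DifferentiableAt.congr_of_eventuallyEq ?_ heq
  exact (differentiableAt_riemannZeta h1).inv (InvZetaRH.riemannZeta_ne_zero_of_RH hRH hs)

/-- Under RH, `zetaInv` is holomorphic on `Re s > 1/2` (removable singularity at `1`). [folklore] -/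
lemma differentiableOn_zetaInv (hRH : RiemannHypothesis) :
    DifferentiableOn ℂ zetaInv {s : ℂ | 1 / 2 < s.re} := by
  intro s hs
  simp only [Set.mem_setOf_eq] at hs
  refine DifferentiableAt.differentiableWithinAt ?_
  by_cases h1 : s = 1
  · subst h1
    refine (Complex.analyticAt_of_differentiable_on_punctured_nhds_of_continuousAt ?_
      continuousAt_zetaInv_one).differentiableAt
    have hopen : IsOpen {z : ℂ | 1 / 2 < z.re} := isOpen_lt continuous_const Complex.continuous_re
    filter_upwards [self_mem_nhdsWithin, mem_nhdsWithin_of_mem_nhds (hopen.mem_nhds hs)]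
      with z hz1 hz
    exact differentiableAt_zetaInv_of_ne_one hRH hz hz1
  · exact differentiableAt_zetaInv_of_ne_one hRH hs h1

/-- Under RH, `zetaInv` is continuous on `Re s > 1/2`. [folklore] -/
lemma continuousOn_zetaInv (hRH : RiemannHypothesis) :
    ContinuousOn zetaInv {s : ℂ | 1 / 2 < s.re} :=
  (differentiableOn_zetaInv hRH).continuousOn

/-- For `Re s ≥ 2`, `‖1/ζ(s)‖ ≤ ∑ n^{-2}` (from `1/ζ(s) = ∑ μ(n) n^{-s}`). [folklore] -/
lemma norm_zetaInv_le_of_two_le {s : ℂ} (hs : 2 ≤ s.re) :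
    ‖zetaInv s‖ ≤ ∑' n : ℕ, 1 / ((n : ℝ) + 1) ^ 2 := by
  have hs1 : 1 < s.re := by linarith
  have hne : s ≠ 1 := by rintro rfl; simp at hs
  have hprod := LSeries_one_mul_Lseries_moebius hs1
  rw [LSeries_one_eq_riemannZeta hs1] at hprod
  have hζ : riemannZeta s ≠ 0 := riemannZeta_ne_zero_of_one_lt_re hs1
  have hinv : (riemannZeta s)⁻¹ = LSeries (fun n => (ArithmeticFunction.moebius n : ℂ)) s := by
    rw [eq_comm, ← mul_right_inj' hζ, hprod, mul_inv_cancel₀ hζ]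
  rw [zetaInv_of_ne_one hne, hinv, LSeries]
  have hbound : ∀ n : ℕ, ‖LSeries.term (fun n => (ArithmeticFunction.moebius n : ℂ)) s n‖ ≤
      (fun n : ℕ => if n = 0 then (0 : ℝ) else 1 / (n : ℝ) ^ 2) n := by
    intro n
    rcases eq_or_ne n 0 with rfl | hn
    · simp
    · simp only [LSeries.term_of_ne_zero hn, hn, ↓reduceIte, norm_div, Complex.norm_intCast,
        Complex.norm_natCast_cpow_of_pos (Nat.pos_of_ne_zero hn)]
      have hn1 : (1 : ℝ) ≤ n := by exact_mod_cast Nat.pos_of_ne_zero hn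
      have hμ : |(ArithmeticFunction.moebius n : ℝ)| ≤ 1 := by
        exact_mod_cast ArithmeticFunction.abs_moebius_le_one
      calc |(ArithmeticFunction.moebius n : ℝ)| / (n : ℝ) ^ s.re ≤ 1 / (n : ℝ) ^ s.re := by
            gcongr
        _ ≤ 1 / (n : ℝ) ^ (2 : ℝ) := by
            exact one_div_le_one_div_of_le (by positivity)
              (Real.rpow_le_rpow_of_exponent_le hn1 hs)
        _ = 1 / (n : ℝ) ^ 2 := by norm_num
  have hsum : Summable fun n : ℕ => if n = 0 then (0 : ℝ) else 1 / (n : ℝ) ^ 2 := by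
    refine (summable_nat_add_iff 1).mp ?_
    simp only [Nat.succ_ne_zero, ↓reduceIte, Nat.cast_add, Nat.cast_one]
    exact_mod_cast Real.summable_one_div_nat_add_rpow 1 2 |>.mpr (by norm_num)
  calc ‖∑' n, LSeries.term (fun n => (ArithmeticFunction.moebius n : ℂ)) s n‖
      ≤ ∑' n : ℕ, (if n = 0 then (0 : ℝ) else 1 / (n : ℝ) ^ 2) :=
        tsum_of_norm_bounded hsum.hasSum hbound
    _ = ∑' n : ℕ, 1 / ((n : ℝ) + 1) ^ 2 := by
        rw [hsum.tsum_eq_zero_add]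
        simp

/-- Uniform polynomially-small bound for `zetaInv` under RH, all `t`: for `σ₀ > 1/2` and `ε > 0`
there is `K` with `‖zetaInv(σ+it)‖ ≤ K (1+|t|)^ε` for all `σ ≥ σ₀` and all real `t`. Large `|t|`:
Littlewood's bound (14.2.6), `‖ζ(σ+it)⁻¹‖ ≤ |t|^ε` for `σ ≥ σ₀`, `|t| ≥ T`, PROVED in
`RHInvZetaBound.lean` (`InvZetaRH.norm_inv_riemannZeta_le_rpow`); `|t| ≤ T₁`, `σ ≤ 2`: continuity
of `zetaInv` on a compact rectangle; `σ ≥ 2`: `∑ n^{-2}`. This is the form in which Titchmarsh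
uses (14.2.6) in the proof of Thm. 14.25 (C) (§14.25: on the segments `1/2 + δ ≤ σ ≤ 2`).
[cite: Titchmarsh1986, Thm 14.2, eq. (14.2.6)] -/
theorem exists_bound_zetaInv (hRH : RiemannHypothesis)
    {σ₀ : ℝ} (hσ₀ : 1 / 2 < σ₀) {ε : ℝ} (hε : 0 < ε) :
    ∃ K : ℝ, 0 < K ∧ ∀ σ t : ℝ, σ₀ ≤ σ → ‖zetaInv (σ + t * I)‖ ≤ K * (1 + |t|) ^ ε := by
  obtain ⟨T, hT⟩ := InvZetaRH.norm_inv_riemannZeta_le_rpow hRH hσ₀ hε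
  -- large `|t|`
  set T₁ : ℝ := max T 1 with hT₁def
  have hlarge : ∀ σ t : ℝ, σ₀ ≤ σ → T₁ ≤ |t| → ‖zetaInv (σ + t * I)‖ ≤ (1 + |t|) ^ ε := by
    intro σ t hσ ht
    have ht1 : 1 ≤ |t| := le_trans (le_max_right _ _) ht
    have htT : T ≤ |t| := le_trans (le_max_left _ _) ht
    have hne : (σ : ℂ) + t * I ≠ 1 := by
      intro h
      have := congrArg Complex.im h
      simp at this
      simp [this] at ht1
      exact absurd ht1 (by norm_num)
    rw [zetaInv_of_ne_one hne]
    refine (hT σ t hσ htT).trans ?_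
    exact Real.rpow_le_rpow (abs_nonneg t) (by linarith) hε.le
  -- compact part
  set R : Set ℂ := Set.Icc σ₀ 2 ×ℂ Set.Icc (-T₁) T₁ with hR
  have hRc : IsCompact R := isCompact_Icc.reProdIm isCompact_Icc
  have hRsub : R ⊆ {s : ℂ | 1 / 2 < s.re} := by
    intro s hs
    rw [hR, mem_reProdIm] at hs
    simp only [Set.mem_setOf_eq]
    linarith [hs.1.1]
  obtain ⟨B, hB⟩ := hRc.exists_bound_of_continuousOn ((continuousOn_zetaInv hRH).mono hRsub)
  set Z : ℝ := ∑' n : ℕ, 1 / ((n : ℝ) + 1) ^ 2 with hZ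
  refine ⟨max 1 (max B Z), lt_of_lt_of_le zero_lt_one (le_max_left _ _), fun σ t hσ => ?_⟩
  have hpow : 1 ≤ (1 + |t|) ^ ε := Real.one_le_rpow (by linarith [abs_nonneg t]) hε.le
  have hK1 : (1 : ℝ) ≤ max 1 (max B Z) := le_max_left _ _
  by_cases ht : T₁ ≤ |t|
  · calc ‖zetaInv (σ + t * I)‖ ≤ (1 + |t|) ^ ε := hlarge σ t hσ ht
      _ = 1 * (1 + |t|) ^ ε := (one_mul _).symm
      _ ≤ max 1 (max B Z) * (1 + |t|) ^ ε := by gcongr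
  by_cases hσ2 : 2 ≤ σ
  · calc ‖zetaInv (σ + t * I)‖ ≤ Z := norm_zetaInv_le_of_two_le (by simpa using hσ2)
      _ ≤ max 1 (max B Z) * 1 := by simp
      _ ≤ max 1 (max B Z) * (1 + |t|) ^ ε := by gcongr
  · have hmem : (σ : ℂ) + t * I ∈ R := by
      rw [hR, mem_reProdIm]
      constructor
      · simp only [add_re, ofReal_re, mul_re, I_re, mul_zero, ofReal_im, I_im, mul_one, sub_self,
          add_zero, Set.mem_Icc]
        exact ⟨hσ, (not_le.mp hσ2).le⟩
      · simp only [add_im, ofReal_im, mul_im, ofReal_re, I_im, mul_one, I_re, mul_zero, add_zero,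
          zero_add, Set.mem_Icc]
        exact abs_le.mp (not_le.mp ht).le
    calc ‖zetaInv (σ + t * I)‖ ≤ B := hB _ hmem
      _ ≤ max 1 (max B Z) * 1 := by simp
      _ ≤ max 1 (max B Z) * (1 + |t|) ^ ε := by gcongr


/-- The piecewise-linear cutoff `φ_h(u) = min(1, max(0, (1+h-u)/h))`: `1` on `[0,1]`, `0` on
`[1+h, ∞)`, linear in between. [folklore] -/
def phi (h u : ℝ) : ℝ := min 1 (max 0 ((1 + h - u) / h))

variable {h : ℝ}

/-- `φ_h(u) = 1` for `u ≤ 1`. [folklore] -/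
lemma phi_of_le_one (hh : 0 < h) {u : ℝ} (hu : u ≤ 1) : phi h u = 1 := by
  unfold phi
  have : 1 ≤ (1 + h - u) / h := by rw [le_div_iff₀ hh]; linarith
  rw [min_eq_left]
  exact le_max_of_le_right this

/-- `φ_h(u) = 0` for `u ≥ 1 + h`. [folklore] -/
lemma phi_of_ge (hh : 0 < h) {u : ℝ} (hu : 1 + h ≤ u) : phi h u = 0 := by
  unfold phi
  have : (1 + h - u) / h ≤ 0 := div_nonpos_of_nonpos_of_nonneg (by linarith) hh.le
  rw [max_eq_left this, min_eq_right zero_le_one]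

/-- `φ_h(u) = (1+h-u)/h` on `[1, 1+h]`. [folklore] -/
lemma phi_of_mem (hh : 0 < h) {u : ℝ} (hu : u ∈ Icc 1 (1 + h)) : phi h u = (1 + h - u) / h := by
  unfold phi
  have h0 : 0 ≤ (1 + h - u) / h := div_nonneg (by linarith [hu.2]) hh.le
  have h1 : (1 + h - u) / h ≤ 1 := by rw [div_le_iff₀ hh]; linarith [hu.1]
  rw [max_eq_right h0, min_eq_right h1]

/-- `0 ≤ φ_h`. [folklore] -/
lemma phi_nonneg (h u : ℝ) : 0 ≤ phi h u := le_min zero_le_one (le_max_left _ _)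

/-- `φ_h ≤ 1`. [folklore] -/
lemma phi_le_one (h u : ℝ) : phi h u ≤ 1 := min_le_left _ _

/-- `|φ_h| ≤ 1`. [folklore] -/
lemma abs_phi_le_one (h u : ℝ) : |phi h u| ≤ 1 := by
  rw [abs_of_nonneg (phi_nonneg h u)]; exact phi_le_one h u

/-- `φ_h` is continuous. [folklore] -/
lemma continuous_phi (h : ℝ) : Continuous (phi h) := by
  unfold phi; fun_prop

/-- The Mellin transform of `φ_h` in closed form: `Φ_h(s) = ((1+h)^{s+1} − 1)/(h s (s+1))`.
[folklore] -/
def Phi (h : ℝ) (s : ℂ) : ℂ := ((((1 + h : ℝ)) : ℂ) ^ (s + 1) - 1) / (h * s * (s + 1))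

/-- `φ_h` (as a complex-valued function) is Mellin-convergent for `Re s > 0`. [folklore] -/
lemma mellinConvergent_phi (hh : 0 < h) {s : ℂ} (hs : 0 < s.re) :
    MellinConvergent (fun u => (phi h u : ℂ)) s := by
  refine mellinConvergent_of_isBigO_rpow (a := s.re + 1) (b := 0) ?_ ?_ (by linarith) ?_ hs
  · exact (continuous_ofReal.comp (continuous_phi h)).continuousOn.locallyIntegrableOn
      measurableSet_Ioi
  · have : (fun u => (phi h u : ℂ)) =ᶠ[atTop] 0 := by
      filter_upwards [eventually_ge_atTop (1 + h)] with u hu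
      simp [phi_of_ge hh hu]
    exact this.trans_isBigO (isBigO_zero _ _)
  · refine IsBigO.of_bound 1 ?_
    filter_upwards [self_mem_nhdsWithin] with u hu
    rw [neg_zero, Real.rpow_zero, norm_one, mul_one, Complex.norm_real, Real.norm_eq_abs]
    exact abs_phi_le_one h u

/-- `mellin φ_h = Φ_h` on `Re s > 0`. [folklore] -/
theorem mellin_phi (hh : 0 < h) {s : ℂ} (hs : 0 < s.re) :
    mellin (fun u => (phi h u : ℂ)) s = Phi h s := by
  have hs0 : s ≠ 0 := fun h0 => by simp [h0] at hs
  have hs1 : s + 1 ≠ 0 := fun h0 => by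
    have := congrArg Complex.re h0; simp at this; linarith
  have hh1 : (0 : ℝ) < 1 + h := by linarith
  have hb : ((1 + h : ℝ) : ℂ) ≠ 0 := by exact_mod_cast hh1.ne'
  set F : ℝ → ℂ := fun t => (t : ℂ) ^ (s - 1) • ((phi h t : ℝ) : ℂ) with hF
  have hint : IntegrableOn F (Ioi 0) := mellinConvergent_phi hh hs
  have hmel : mellin (fun u => (phi h u : ℂ)) s = ∫ t in Ioi 0, F t := rfl
  rw [hmel, ← Ioc_union_Ioi_eq_Ioi hh1.le, setIntegral_union (Ioc_disjoint_Ioi le_rfl)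
    measurableSet_Ioi (hint.mono_set Ioc_subset_Ioi_self) (hint.mono_set (Ioi_subset_Ioi hh1.le))]
  have htail : ∫ t in Ioi (1 + h), F t = 0 := by
    refine setIntegral_eq_zero_of_forall_eq_zero fun t ht => ?_
    simp [hF, phi_of_ge hh (le_of_lt ht)]
  rw [htail, add_zero, ← intervalIntegral.integral_of_le hh1.le]
  -- split at `1`
  have hii : ∀ a b : ℝ, 0 ≤ a → a ≤ b → IntervalIntegrable F volume a b := by
    intro a b ha hab
    rw [intervalIntegrable_iff_integrableOn_Ioc_of_le hab]
    exact hint.mono_set (Ioc_subset_Ioi_self.trans (Ioi_subset_Ioi ha))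
  rw [← intervalIntegral.integral_add_adjacent_intervals (hii 0 1 le_rfl zero_le_one)
    (hii 1 (1 + h) zero_le_one (by linarith))]
  -- first piece
  have h1 : ∫ t in (0 : ℝ)..1, F t = 1 / s := by
    have : ∫ t in (0 : ℝ)..1, F t = ∫ t in (0 : ℝ)..1, (t : ℂ) ^ (s - 1) := by
      refine intervalIntegral.integral_congr fun t ht => ?_
      rw [uIcc_of_le zero_le_one] at ht
      simp [hF, phi_of_le_one hh ht.2]
    rw [this, integral_cpow (Or.inl (by simp [hs]))]
    simp [sub_add_cancel, zero_cpow hs0]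
  -- second piece
  have h2 : ∫ t in (1 : ℝ)..(1 + h), F t =
      ((1 + h : ℝ) : ℂ) / h * ((((1 + h : ℝ) : ℂ) ^ s - 1) / s) -
        1 / h * ((((1 + h : ℝ) : ℂ) ^ (s + 1) - 1) / (s + 1)) := by
    have heq : ∫ t in (1 : ℝ)..(1 + h), F t = ∫ t in (1 : ℝ)..(1 + h),
        (((1 + h : ℝ) : ℂ) / h * (t : ℂ) ^ (s - 1) - 1 / h * (t : ℂ) ^ s) := by
      refine intervalIntegral.integral_congr fun t ht => ?_
      rw [uIcc_of_le (by linarith)] at ht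
      have ht0 : (t : ℂ) ≠ 0 := by
        have : (0 : ℝ) < t := by linarith [ht.1]
        exact_mod_cast this.ne'
      simp only [hF, phi_of_mem hh ht, smul_eq_mul]
      have : (t : ℂ) ^ s = (t : ℂ) ^ (s - 1) * t := by
        conv_lhs => rw [← sub_add_cancel s 1, cpow_add _ _ ht0, cpow_one]
      rw [this]
      push_cast
      field_simp
    rw [heq, intervalIntegral.integral_sub, intervalIntegral.integral_const_mul,
      intervalIntegral.integral_const_mul, integral_cpow (Or.inl (by simp [hs])),
      integral_cpow (Or.inl (by linarith))]
    · simp only [sub_add_cancel, ofReal_one, one_cpow]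
    · exact ((intervalIntegral.intervalIntegrable_cpow (r := s - 1) (Or.inr (by
        rw [uIcc_of_le (by linarith)]; intro h0; simp at h0; linarith [h0.1]))).const_mul _)
    · exact ((intervalIntegral.intervalIntegrable_cpow (r := s) (Or.inr (by
        rw [uIcc_of_le (by linarith)]; intro h0; simp at h0; linarith [h0.1]))).const_mul _)
  rw [h1, h2, Phi]
  have hP : ((1 + h : ℝ) : ℂ) ^ (s + 1) = ((1 + h : ℝ) : ℂ) ^ s * ((1 + h : ℝ) : ℂ) := by
    rw [cpow_add _ _ hb, cpow_one]
  rw [hP]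
  have hh0 : (h : ℂ) ≠ 0 := by exact_mod_cast hh.ne'
  field_simp
  push_cast
  ring

/-- Crude bound `‖(1+h)^{s+1} − 1‖ ≤ 9` for `0 < h ≤ 1`, `-1 ≤ Re s ≤ 2`. [folklore] -/
lemma norm_cpow_sub_one_le_nine (hh : 0 < h) (hh1 : h ≤ 1) {s : ℂ} (hs0 : -1 ≤ s.re)
    (hs2 : s.re ≤ 2) : ‖((1 + h : ℝ) : ℂ) ^ (s + 1) - 1‖ ≤ 9 := by
  have hb : (0 : ℝ) < 1 + h := by linarith
  refine (norm_sub_le _ _).trans ?_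
  rw [norm_one, Complex.norm_cpow_eq_rpow_re_of_pos hb]
  have hre : (s + 1).re = s.re + 1 := by simp
  rw [hre]
  have : (1 + h) ^ (s.re + 1) ≤ (2 : ℝ) ^ (3 : ℝ) := by
    calc (1 + h) ^ (s.re + 1) ≤ (2 : ℝ) ^ (s.re + 1) :=
          Real.rpow_le_rpow (by linarith) (by linarith) (by linarith)
      _ ≤ (2 : ℝ) ^ (3 : ℝ) := Real.rpow_le_rpow_of_exponent_le (by norm_num) (by linarith)
  norm_num at this
  linarith

/-- Mean-value bound `‖(1+h)^{s+1} − 1‖ ≤ 8 ‖s+1‖ h` for `0 < h ≤ 1`, `Re s ≤ 2`. [folklore] -/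
lemma norm_cpow_sub_one_le_mul (hh : 0 < h) (hh1 : h ≤ 1) {s : ℂ}
    (hs2 : s.re ≤ 2) : ‖((1 + h : ℝ) : ℂ) ^ (s + 1) - 1‖ ≤ 8 * ‖s + 1‖ * h := by
  have hb : (0 : ℝ) < 1 + h := by linarith
  set L : ℝ := Real.log (1 + h) with hL
  have hL0 : 0 ≤ L := Real.log_nonneg (by linarith)
  have hLh : L ≤ h := by have := Real.log_le_sub_one_of_pos hb; rw [hL]; linarith
  have hexpL : Real.exp (3 * L) ≤ 8 := by
    rw [hL, mul_comm, Real.exp_mul, Real.exp_log hb]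
    have : (1 + h) ^ (3 : ℝ) ≤ (2 : ℝ) ^ (3 : ℝ) :=
      Real.rpow_le_rpow (by linarith) (by linarith) (by norm_num)
    refine this.trans ?_
    norm_num
  -- `g(u) = exp((s+1) u)` on `[0, L]`
  have key := norm_image_sub_le_of_norm_deriv_le_segment' (f := fun u : ℝ => cexp ((s + 1) * u))
    (f' := fun u : ℝ => cexp ((s + 1) * u) * ((s + 1) * 1)) (a := 0) (b := L)
    (C := 8 * ‖s + 1‖) (fun u _ => ?_) (fun u hu => ?_) L ⟨hL0, le_rfl⟩
  · have e1 : cexp ((s + 1) * (L : ℝ)) = ((1 + h : ℝ) : ℂ) ^ (s + 1) := by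
      rw [cpow_def_of_ne_zero (by exact_mod_cast hb.ne'), ← Complex.ofReal_log hb.le, hL, mul_comm]
    have key' : ‖((1 + h : ℝ) : ℂ) ^ (s + 1) - 1‖ ≤ 8 * ‖s + 1‖ * L := by simpa [e1] using key
    refine key'.trans ?_
    gcongr
  · exact (((hasDerivAt_id u).ofReal_comp.const_mul (s + 1)).cexp).hasDerivWithinAt
  · rw [norm_mul, norm_mul, norm_one, mul_one, Complex.norm_exp]
    have hre : ((s + 1) * (u : ℂ)).re = (s.re + 1) * u := by simp
    rw [hre]
    have hu' : (s.re + 1) * u ≤ 3 * L := by nlinarith [hu.1, hu.2]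
    have : Real.exp ((s.re + 1) * u) ≤ 8 := (Real.exp_le_exp.mpr hu').trans hexpL
    calc Real.exp ((s.re + 1) * u) * ‖s + 1‖ ≤ 8 * ‖s + 1‖ := by gcongr
      _ = 8 * ‖s + 1‖ := rfl

/-- `‖s‖ ≤ ‖s + 1‖` when `Re s ≥ 0`. [folklore] -/
lemma norm_le_norm_add_one {s : ℂ} (hs : 0 ≤ s.re) : ‖s‖ ≤ ‖s + 1‖ := by
  rw [← Real.sqrt_sq (norm_nonneg s), ← Real.sqrt_sq (norm_nonneg (s + 1)),
    Complex.sq_norm, Complex.sq_norm]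
  refine Real.sqrt_le_sqrt ?_
  simp only [Complex.normSq_apply, add_re, one_re, add_im, one_im, add_zero]
  nlinarith

/-- `‖Φ_h(s)‖ ≤ 9/(h ‖s‖²)` for `0 < h ≤ 1`, `0 < Re s ≤ 2`. [folklore] -/
lemma norm_Phi_le_sq (hh : 0 < h) (hh1 : h ≤ 1) {s : ℂ} (hs0 : 0 < s.re) (hs2 : s.re ≤ 2) :
    ‖Phi h s‖ ≤ 9 / (h * ‖s‖ ^ 2) := by
  have hsn : 0 < ‖s‖ := norm_pos_iff.mpr fun h0 => by simp [h0] at hs0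
  have hs1n : ‖s‖ ≤ ‖s + 1‖ := norm_le_norm_add_one hs0.le
  rw [Phi, norm_div, norm_mul, norm_mul, Complex.norm_real, Real.norm_eq_abs, abs_of_pos hh]
  have hden : h * ‖s‖ ^ 2 ≤ h * ‖s‖ * ‖s + 1‖ := by
    rw [sq, ← mul_assoc]; gcongr
  calc ‖((1 + h : ℝ) : ℂ) ^ (s + 1) - 1‖ / (h * ‖s‖ * ‖s + 1‖) ≤ 9 / (h * ‖s‖ * ‖s + 1‖) := by
        gcongr; exact norm_cpow_sub_one_le_nine hh hh1 (by linarith) hs2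
    _ ≤ 9 / (h * ‖s‖ ^ 2) := by
        gcongr

/-- `‖Φ_h(s)‖ ≤ 8/‖s‖` for `0 < h ≤ 1`, `0 < Re s ≤ 2`. [folklore] -/
lemma norm_Phi_le (hh : 0 < h) (hh1 : h ≤ 1) {s : ℂ} (hs0 : 0 < s.re) (hs2 : s.re ≤ 2) :
    ‖Phi h s‖ ≤ 8 / ‖s‖ := by
  have hsn : 0 < ‖s‖ := norm_pos_iff.mpr fun h0 => by simp [h0] at hs0
  have hs1n : 0 < ‖s + 1‖ := lt_of_lt_of_le hsn (norm_le_norm_add_one hs0.le)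
  rw [Phi, norm_div, norm_mul, norm_mul, Complex.norm_real, Real.norm_eq_abs, abs_of_pos hh]
  rw [div_le_div_iff₀ (by positivity) hsn]
  calc ‖((1 + h : ℝ) : ℂ) ^ (s + 1) - 1‖ * ‖s‖ ≤ (8 * ‖s + 1‖ * h) * ‖s‖ := by
        gcongr; exact norm_cpow_sub_one_le_mul hh hh1 hs2
    _ = 8 * (h * ‖s‖ * ‖s + 1‖) := by ring

/-- Interpolated bound `‖Φ_h(s)‖ ≤ 9 h^{-2ε} ‖s‖^{-1-2ε}` (`0 < ε ≤ 1/2`). [folklore] -/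
lemma norm_Phi_le_rpow (hh : 0 < h) (hh1 : h ≤ 1) {s : ℂ} (hs0 : 0 < s.re) (hs2 : s.re ≤ 2)
    {ε : ℝ} (hε : 0 < ε) (hε2 : ε ≤ 1 / 2) :
    ‖Phi h s‖ ≤ 9 * h ^ (-(2 * ε)) * ‖s‖ ^ (-(1 + 2 * ε)) := by
  have hsn : 0 < ‖s‖ := norm_pos_iff.mpr fun h0 => by simp [h0] at hs0
  have hA : ‖Phi h s‖ ≤ 9 / ‖s‖ := (norm_Phi_le hh hh1 hs0 hs2).trans (by gcongr; norm_num)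
  have hB := norm_Phi_le_sq hh hh1 hs0 hs2
  have h0 : 0 ≤ ‖Phi h s‖ := norm_nonneg _
  -- `‖Φ‖ = ‖Φ‖^{1-2ε} ‖Φ‖^{2ε} ≤ (9/‖s‖)^{1-2ε} (9/(h‖s‖²))^{2ε}`
  have hsplit : ‖Phi h s‖ = ‖Phi h s‖ ^ (1 - 2 * ε) * ‖Phi h s‖ ^ (2 * ε) := by
    rw [← Real.rpow_add' h0 (by ring_nf; norm_num)]; ring_nf; simp
  rw [hsplit]
  calc ‖Phi h s‖ ^ (1 - 2 * ε) * ‖Phi h s‖ ^ (2 * ε)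
      ≤ (9 / ‖s‖) ^ (1 - 2 * ε) * (9 / (h * ‖s‖ ^ 2)) ^ (2 * ε) := by
        gcongr
        · linarith
    _ = 9 * h ^ (-(2 * ε)) * ‖s‖ ^ (-(1 + 2 * ε)) := by
        have e1 : (9 / ‖s‖) ^ (1 - 2 * ε) = 9 ^ (1 - 2 * ε) * ‖s‖ ^ (-(1 - 2 * ε)) := by
          rw [Real.div_rpow (by norm_num) hsn.le, Real.rpow_neg hsn.le, div_eq_mul_inv]
        have e2 : (9 / (h * ‖s‖ ^ 2)) ^ (2 * ε) =
            9 ^ (2 * ε) * (h ^ (-(2 * ε)) * ‖s‖ ^ (-(2 * (2 * ε)))) := by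
          rw [Real.div_rpow (by norm_num) (by positivity), Real.mul_rpow hh.le (by positivity),
            show (‖s‖ ^ 2 : ℝ) = ‖s‖ ^ (2 : ℝ) by norm_num, ← Real.rpow_mul hsn.le,
            Real.rpow_neg hh.le, Real.rpow_neg hsn.le, div_eq_mul_inv, mul_inv]
        have e3 : (9 : ℝ) ^ (1 - 2 * ε) * 9 ^ (2 * ε) = 9 := by
          rw [← Real.rpow_add (by norm_num)]; norm_num
        have e4 : ‖s‖ ^ (-(1 - 2 * ε)) * ‖s‖ ^ (-(2 * (2 * ε))) = ‖s‖ ^ (-(1 + 2 * ε)) := by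
          rw [← Real.rpow_add hsn]; congr 1; ring
        rw [e1, e2]
        calc 9 ^ (1 - 2 * ε) * ‖s‖ ^ (-(1 - 2 * ε)) *
              (9 ^ (2 * ε) * (h ^ (-(2 * ε)) * ‖s‖ ^ (-(2 * (2 * ε)))))
            = (9 ^ (1 - 2 * ε) * 9 ^ (2 * ε)) * h ^ (-(2 * ε)) *
                (‖s‖ ^ (-(1 - 2 * ε)) * ‖s‖ ^ (-(2 * (2 * ε)))) := by ring
          _ = 9 * h ^ (-(2 * ε)) * ‖s‖ ^ (-(1 + 2 * ε)) := by rw [e3, e4]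

/-- `Φ_h` is holomorphic away from `s = 0, -1`. [folklore] -/
lemma differentiableAt_Phi (h : ℝ) {s : ℂ} (hs0 : s ≠ 0) (hs1 : s + 1 ≠ 0) (hh : h ≠ 0) :
    DifferentiableAt ℂ (Phi h) s := by
  unfold Phi
  refine DifferentiableAt.div ?_ ?_ ?_
  · refine DifferentiableAt.sub_const ?_ 1
    by_cases hb : ((1 + h : ℝ) : ℂ) = 0
    · -- degenerate base `1 + h = 0`: `0 ^ (s+1)` is locally constant `0` near `s` (as `s + 1 ≠ 0`)
      have : (fun z : ℂ => ((1 + h : ℝ) : ℂ) ^ (z + 1)) =ᶠ[𝓝 s] fun _ => 0 := by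
        have hopen : IsOpen {z : ℂ | z + 1 ≠ 0} := isOpen_ne_fun (by fun_prop) (by fun_prop)
        filter_upwards [hopen.mem_nhds hs1] with z hz
        rw [hb, zero_cpow hz]
      exact (differentiableAt_const _).congr_of_eventuallyEq this
    · exact (differentiableAt_id.add_const 1).const_cpow (Or.inl hb)
  · fun_prop
  · have : (h : ℂ) ≠ 0 := by exact_mod_cast hh
    exact mul_ne_zero (mul_ne_zero this hs0) hs1

/-- `Φ_h` is continuous on `Re s > 0` (`h ≠ 0`). [folklore] -/
lemma continuousOn_Phi (h : ℝ) (hh : h ≠ 0) : ContinuousOn (Phi h) {s : ℂ | 0 < s.re} := by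
  intro s hs
  simp only [Set.mem_setOf_eq] at hs
  have hs0 : s ≠ 0 := fun h0 => by simp [h0] at hs
  have hs1 : s + 1 ≠ 0 := fun h0 => by have := congrArg Complex.re h0; simp at this; linarith
  exact (differentiableAt_Phi h hs0 hs1 hh).continuousAt.continuousWithinAt

/-- Continuity of `t ↦ Φ_h(σ + it)` for `σ > 0`. [folklore] -/
lemma continuous_Phi_vertical (hh : h ≠ 0) {σ : ℝ} (hσ : 0 < σ) :
    Continuous fun t : ℝ => Phi h (σ + t * I) := by
  have hline : Continuous fun t : ℝ => (σ : ℂ) + t * I := by fun_prop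
  refine (continuousOn_Phi h hh).comp_continuous hline fun t => ?_
  simp [hσ]

/-- `‖Φ_h(σ+it)‖ ≤ (9/(h min(σ²,1))) (1+t²)⁻¹` for `0 < h ≤ 1`, `0 < σ ≤ 2`. [folklore] -/
lemma norm_Phi_vertical_le (hh : 0 < h) (hh1 : h ≤ 1) {σ : ℝ} (hσ : 0 < σ) (hσ2 : σ ≤ 2) (t : ℝ) :
    ‖Phi h (σ + t * I)‖ ≤ 9 / (h * min (σ ^ 2) 1) * (1 + t ^ 2)⁻¹ := by
  have hre : ((σ : ℂ) + t * I).re = σ := by simp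
  have h1 := norm_Phi_le_sq hh hh1 (s := σ + t * I) (by rw [hre]; exact hσ) (by rw [hre]; exact hσ2)
  refine h1.trans ?_
  have hnorm : ‖(σ : ℂ) + t * I‖ ^ 2 = σ ^ 2 + t ^ 2 := by
    rw [Complex.sq_norm, Complex.normSq_apply]; simp; ring
  rw [hnorm]
  have hm : 0 < min (σ ^ 2) 1 := lt_min (by positivity) one_pos
  have hkey : min (σ ^ 2) 1 * (1 + t ^ 2) ≤ σ ^ 2 + t ^ 2 := by
    have := min_le_left (σ ^ 2) 1
    have := min_le_right (σ ^ 2) 1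
    nlinarith [sq_nonneg t]
  have hpos : 0 < σ ^ 2 + t ^ 2 := by positivity
  rw [show 9 / (h * min (σ ^ 2) 1) * (1 + t ^ 2)⁻¹ = 9 / (h * (min (σ ^ 2) 1 * (1 + t ^ 2))) by
    field_simp]
  gcongr

/-- Integrability of `t ↦ Φ_h(σ + it)` for `0 < h ≤ 1`, `0 < σ ≤ 2`. [folklore] -/
lemma integrable_Phi_vertical (hh : 0 < h) (hh1 : h ≤ 1) {σ : ℝ} (hσ : 0 < σ) (hσ2 : σ ≤ 2) :
    Integrable fun t : ℝ => Phi h (σ + t * I) := by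
  refine Integrable.mono' ((integrable_inv_one_add_sq).const_mul (9 / (h * min (σ ^ 2) 1)))
    (continuous_Phi_vertical hh.ne' hσ).aestronglyMeasurable (Eventually.of_forall fun t => ?_)
  exact norm_Phi_vertical_le hh hh1 hσ hσ2 t

/-- Mellin inversion for the cutoff: `φ_h(y) = (1/2π) ∫ y^{-(σ+it)} Φ_h(σ+it) dt` (`y > 0`,
`0 < σ ≤ 2`), from Mathlib's `mellinInv_mellin_eq`. [folklore] -/
theorem mellinInv_Phi (hh : 0 < h) (hh1 : h ≤ 1) {σ : ℝ} (hσ : 0 < σ) (hσ2 : σ ≤ 2) {y : ℝ}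
    (hy : 0 < y) : mellinInv σ (Phi h) y = (phi h y : ℂ) := by
  have hmel : ∀ t : ℝ, mellin (fun u => (phi h u : ℂ)) (σ + t * I) = Phi h (σ + t * I) :=
    fun t => mellin_phi hh (by simp [hσ])
  have hinv := mellinInv_mellin_eq σ (fun u => (phi h u : ℂ)) hy
    (mellinConvergent_phi hh (by simp [hσ])) ?_ ?_
  · rw [← hinv]
    unfold mellinInv
    congr 1
    refine integral_congr_ae (Eventually.of_forall fun t => ?_)
    simp only [hmel]
  · unfold VerticalIntegrable
    simp_rw [hmel]
    exact integrable_Phi_vertical hh hh1 hσ hσ2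
  · exact (continuous_ofReal.comp (continuous_phi h)).continuousAt


/-- For positive reals `a, x`: `x^s / a^s = (a/x)^{-s}`. [folklore] -/
lemma cpow_div_cpow_eq {a x : ℝ} (ha : 0 < a) (hx : 0 < x) (s : ℂ) :
    (x : ℂ) ^ s / (a : ℂ) ^ s = ((a / x : ℝ) : ℂ) ^ (-s) := by
  have hax : (0 : ℝ) < a / x := div_pos ha hx
  rw [cpow_def_of_ne_zero (by exact_mod_cast hx.ne'),
    cpow_def_of_ne_zero (by exact_mod_cast ha.ne'),
    cpow_def_of_ne_zero (by exact_mod_cast hax.ne'), ← Complex.ofReal_log hx.le,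
    ← Complex.ofReal_log ha.le, ← Complex.ofReal_log hax.le, Real.log_div ha.ne' hx.ne',
    ← Complex.exp_sub]
  congr 1
  push_cast
  ring

/-- On `Re s > 1`, `1/ζ(s) = ∑ μ(n) n^{-s}` (Mathlib). [folklore] -/
lemma inv_riemannZeta_eq_LSeries {s : ℂ} (hs : 1 < s.re) :
    (riemannZeta s)⁻¹ = LSeries (fun n => (ArithmeticFunction.moebius n : ℂ)) s := by
  have hprod := LSeries_one_mul_Lseries_moebius hs
  rw [LSeries_one_eq_riemannZeta hs] at hprod
  have hζ : riemannZeta s ≠ 0 := riemannZeta_ne_zero_of_one_lt_re hs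
  rw [eq_comm, ← mul_right_inj' hζ, hprod, mul_inv_cancel₀ hζ]

/-- **Smoothed Perron formula on `Re s = 2`.** For a function `Φ` integrable on the line `Re s = 2`
whose inverse Mellin transform at abscissa `2` is `φ` on `(0, ∞)`, and `x > 0`:
`∫ Φ(2+it) x^{2+it} ζ(2+it)^{-1} dt = 2π ∑' μ(n) φ(n/x)`. [folklore] -/
theorem integral_vertical_two_eq_tsum (Φ : ℂ → ℂ) (φ : ℝ → ℂ)
    (hΦi : Integrable fun t : ℝ => Φ (2 + t * I))
    (hinv : ∀ y : ℝ, 0 < y → mellinInv 2 Φ y = φ y) {x : ℝ} (hx : 0 < x) :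
    ∫ t : ℝ, Φ (2 + t * I) * (x : ℂ) ^ (2 + t * I : ℂ) * (riemannZeta (2 + t * I))⁻¹ =
      2 * π * ∑' n : ℕ, (ArithmeticFunction.moebius n : ℂ) * φ (n / x) := by
  set μf : ℕ → ℂ := fun n => (ArithmeticFunction.moebius n : ℂ) with hμf
  set F : ℕ → ℝ → ℂ := fun n t =>
    ((x : ℂ) ^ (2 + t * I : ℂ) * LSeries.term μf (2 + t * I) n) * Φ (2 + t * I) with hF
  have hre : ∀ t : ℝ, (2 + t * I : ℂ).re = 2 := fun t => by simp
  have hxs : ∀ t : ℝ, ‖(x : ℂ) ^ (2 + t * I : ℂ)‖ = x ^ (2 : ℝ) := fun t => by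
    rw [Complex.norm_cpow_eq_rpow_re_of_pos hx, hre]
  -- norm of the terms
  have hterm : ∀ (n : ℕ) (t : ℝ), ‖LSeries.term μf (2 + t * I) n‖ =
      if n = 0 then 0 else ‖μf n‖ / (n : ℝ) ^ (2 : ℝ) := by
    intro n t
    rcases eq_or_ne n 0 with rfl | hn
    · simp
    · rw [LSeries.term_of_ne_zero hn, if_neg hn, norm_div,
        Complex.norm_natCast_cpow_of_pos (Nat.pos_of_ne_zero hn), hre]
  have hterm_le : ∀ (n : ℕ) (t : ℝ), ‖LSeries.term μf (2 + t * I) n‖ ≤ 1 := by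
    intro n t
    rw [hterm]
    split_ifs with hn
    · exact zero_le_one
    · have hn1 : (1 : ℝ) ≤ n := by exact_mod_cast Nat.pos_of_ne_zero hn
      have hμ : ‖μf n‖ ≤ 1 := by
        rw [hμf]; simp only [Complex.norm_intCast]
        exact_mod_cast ArithmeticFunction.abs_moebius_le_one
      have hn2 : (1 : ℝ) ≤ (n : ℝ) ^ (2 : ℝ) := Real.one_le_rpow hn1 (by norm_num)
      calc ‖μf n‖ / (n : ℝ) ^ (2 : ℝ) ≤ 1 / 1 :=
            div_le_div₀ zero_le_one hμ one_pos hn2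
        _ = 1 := by norm_num
  -- continuity in `t` of the pieces
  have hline : Continuous fun t : ℝ => (2 + t * I : ℂ) := by fun_prop
  have hxc : Continuous fun t : ℝ => (x : ℂ) ^ (2 + t * I : ℂ) :=
    hline.const_cpow (Or.inl (by exact_mod_cast hx.ne'))
  have htc : ∀ n : ℕ, Continuous fun t : ℝ => LSeries.term μf (2 + t * I) n := by
    intro n
    rcases eq_or_ne n 0 with rfl | hn
    · simp only [LSeries.term_zero]; exact continuous_const
    · simp only [LSeries.term_of_ne_zero hn]
      refine continuous_const.div (hline.const_cpow (Or.inl (by exact_mod_cast hn))) fun t => ?_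
      exact (cpow_ne_zero_iff_of_exponent_ne_zero (by
        intro h0; have := congrArg Complex.re h0; simp at this)).mpr (by exact_mod_cast hn)
  -- integrability of each `F n`
  have hFi : ∀ n : ℕ, Integrable (F n) := by
    intro n
    refine hΦi.bdd_mul (c := x ^ (2 : ℝ) * 1) (hxc.mul (htc n)).aestronglyMeasurable
      (Eventually.of_forall fun t => ?_)
    rw [norm_mul, hxs]
    gcongr
    exact hterm_le n t
  -- the norms integrate to `x² ‖μ n‖ n^{-2} ∫ ‖Φ‖`
  have hFnorm : ∀ n : ℕ, ∫ t : ℝ, ‖F n t‖ =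
      (x ^ (2 : ℝ) * (if n = 0 then 0 else ‖μf n‖ / (n : ℝ) ^ (2 : ℝ))) *
        ∫ t : ℝ, ‖Φ (2 + t * I)‖ := by
    intro n
    rw [← integral_const_mul]
    refine integral_congr_ae (Eventually.of_forall fun t => ?_)
    simp only [hF, norm_mul, hxs, hterm]
  have hsum : Summable fun n : ℕ => ∫ t : ℝ, ‖F n t‖ := by
    simp_rw [hFnorm]
    refine (Summable.mul_right _ (Summable.mul_left _ ?_))
    refine Summable.of_nonneg_of_le (f := fun n : ℕ => 1 / (n : ℝ) ^ (2 : ℝ)) (fun n => ?_)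
      (fun n => ?_) (Real.summable_one_div_nat_rpow.mpr (by norm_num))
    · split_ifs <;> positivity
    · split_ifs with hn
      · positivity
      · gcongr
        rw [hμf]; simp only [Complex.norm_intCast]
        exact_mod_cast ArithmeticFunction.abs_moebius_le_one
  -- rewrite the integrand as `∑' F n t`
  have hexpand : ∀ t : ℝ, Φ (2 + t * I) * (x : ℂ) ^ (2 + t * I : ℂ) * (riemannZeta (2 + t * I))⁻¹ =
      ∑' n : ℕ, F n t := by
    intro t
    rw [inv_riemannZeta_eq_LSeries (by rw [hre]; norm_num), LSeries, ← tsum_mul_left]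
    refine tsum_congr fun n => ?_
    simp only [hF]; ring
  simp_rw [hexpand]
  rw [← integral_tsum_of_summable_integral_norm hFi hsum]
  -- evaluate `∫ F n`
  have hFint : ∀ n : ℕ, ∫ t : ℝ, F n t = 2 * π * (μf n * φ (n / x)) := by
    intro n
    rcases eq_or_ne n 0 with rfl | hn
    · simp [hF, hμf]
    · have hn0 : (0 : ℝ) < n := by exact_mod_cast Nat.pos_of_ne_zero hn
      have hnx : (0 : ℝ) < n / x := div_pos hn0 hx
      have hFn : ∀ t : ℝ, F n t =
          μf n * ((((n / x : ℝ) : ℂ)) ^ (-(2 + t * I : ℂ)) • Φ (2 + t * I)) := by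
        intro t
        simp only [hF, LSeries.term_of_ne_zero hn, smul_eq_mul]
        rw [← cpow_div_cpow_eq hn0 hx]
        push_cast
        ring
      simp_rw [hFn]
      rw [integral_const_mul, ← hinv _ hnx, mellinInv]
      rw [Complex.real_smul]
      push_cast
      field_simp
      simp only [mul_comm I]
  simp_rw [hFint]
  rw [tsum_mul_left]


/-- **Shifting the line of integration.** If `F` is holomorphic on the closed strip
`a ≤ Re s ≤ b`, integrable on both boundary lines, and `F(σ + iT) → 0` as `|T| → ∞` uniformly in
`σ ∈ [a, b]`, then `∫ F(a+it) dt = ∫ F(b+it) dt` (Cauchy's theorem on `[a,b] × [-T,T]`, `T → ∞`).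
[folklore] -/
theorem integral_vertical_eq_of_tendsto (F : ℂ → ℂ) {a b : ℝ} (hab : a ≤ b)
    (hFd : DifferentiableOn ℂ F (Icc a b ×ℂ univ))
    (hFa : Integrable fun t : ℝ => F (a + t * I))
    (hFb : Integrable fun t : ℝ => F (b + t * I))
    (hdecay : ∀ ε : ℝ, 0 < ε → ∃ T₀ : ℝ, ∀ σ ∈ Icc a b, ∀ T : ℝ, T₀ ≤ |T| → ‖F (σ + T * I)‖ ≤ ε) :
    ∫ t : ℝ, F (a + t * I) = ∫ t : ℝ, F (b + t * I) := by
  -- Cauchy on the rectangle with corners `a - iT`, `b + iT`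
  have hrect : ∀ T : ℝ,
      (∫ x in a..b, F (x + (-T : ℝ) * I)) - (∫ x in a..b, F (x + T * I)) +
        I • (∫ y in (-T : ℝ)..T, F (b + y * I)) - I • (∫ y in (-T : ℝ)..T, F (a + y * I)) = 0 := by
    intro T
    have := Complex.integral_boundary_rect_eq_zero_of_differentiableOn F (a + (-T : ℝ) * I)
      (b + T * I) (hFd.mono ?_)
    · simpa using this
    · intro z hz
      rw [mem_reProdIm] at hz ⊢
      refine ⟨?_, mem_univ _⟩
      have h1 : z.re ∈ uIcc a b := by simpa using hz.1
      rwa [uIcc_of_le hab] at h1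
  -- limits of the vertical pieces
  have hVa : Tendsto (fun T : ℝ => ∫ y in (-T : ℝ)..T, F (a + y * I)) atTop
      (𝓝 (∫ t : ℝ, F (a + t * I))) :=
    intervalIntegral_tendsto_integral hFa tendsto_neg_atTop_atBot tendsto_id
  have hVb : Tendsto (fun T : ℝ => ∫ y in (-T : ℝ)..T, F (b + y * I)) atTop
      (𝓝 (∫ t : ℝ, F (b + t * I))) :=
    intervalIntegral_tendsto_integral hFb tendsto_neg_atTop_atBot tendsto_id
  -- limits of the horizontal pieces
  have hH : ∀ s : ℝ, s = 1 ∨ s = -1 →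
      Tendsto (fun T : ℝ => ∫ x in a..b, F (x + (s * T : ℝ) * I)) atTop (𝓝 0) := by
    intro s hs
    rw [NormedAddGroup.tendsto_nhds_zero]
    intro ε hε
    obtain ⟨T₀, hT₀⟩ := hdecay (ε / (2 * (|b - a| + 1))) (by positivity)
    filter_upwards [eventually_ge_atTop (max T₀ 0)] with T hT
    have hTabs : T₀ ≤ |s * T| := by
      rcases hs with rfl | rfl <;> simp [abs_of_nonneg (le_of_max_le_right hT)] <;>
        exact le_of_max_le_left hT
    have hbound : ∀ x ∈ uIoc a b, ‖F (x + (s * T : ℝ) * I)‖ ≤ ε / (2 * (|b - a| + 1)) := by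
      intro x hx
      rw [uIoc_of_le hab] at hx
      exact hT₀ x ⟨hx.1.le, hx.2⟩ _ hTabs
    refine (intervalIntegral.norm_integral_le_of_norm_le_const hbound).trans_lt ?_
    rw [div_mul_eq_mul_div, div_lt_iff₀ (by positivity)]
    nlinarith [abs_nonneg (b - a)]
  have hH1 := hH 1 (Or.inl rfl)
  have hH2 := hH (-1) (Or.inr rfl)
  simp only [one_mul] at hH1
  simp only [neg_mul, one_mul] at hH2
  -- combine
  have hlim : Tendsto (fun T : ℝ =>
      (∫ x in a..b, F (x + (-T : ℝ) * I)) - (∫ x in a..b, F (x + T * I)) +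
        I • (∫ y in (-T : ℝ)..T, F (b + y * I)) - I • (∫ y in (-T : ℝ)..T, F (a + y * I))) atTop
      (𝓝 (0 - 0 + I • (∫ t : ℝ, F (b + t * I)) - I • (∫ t : ℝ, F (a + t * I)))) :=
    ((hH2.sub hH1).add (hVb.const_smul I)).sub (hVa.const_smul I)
  have hconst : Tendsto (fun T : ℝ =>
      (∫ x in a..b, F (x + (-T : ℝ) * I)) - (∫ x in a..b, F (x + T * I)) +
        I • (∫ y in (-T : ℝ)..T, F (b + y * I)) - I • (∫ y in (-T : ℝ)..T, F (a + y * I))) atTop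
      (𝓝 0) := by
    simp_rw [hrect]; exact tendsto_const_nhds
  have heq := tendsto_nhds_unique hlim hconst
  simp only [sub_zero, zero_add, smul_eq_mul] at heq
  have : I * ((∫ t : ℝ, F (b + t * I)) - ∫ t : ℝ, F (a + t * I)) = 0 := by rw [mul_sub]; exact heq
  rw [mul_eq_zero, sub_eq_zero] at this
  rcases this with hI | h
  · exact absurd hI I_ne_zero
  · exact h.symm


/-! ## Assembly: the integrand `Φ_h(s) x^s ζ(s)^{-1}` and the smoothed explicit formula -/

/-- The integrand `F_{h,x}(s) = Φ_h(s) x^s ζinv(s)` of the smoothed Perron integral. [folklore] -/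
def Fint (h x : ℝ) (s : ℂ) : ℂ := Phi h s * (x : ℂ) ^ s * zetaInv s

variable {x : ℝ}

/-- Under RH, the integrand `F_{h,x}` is differentiable at every `s` with `Re s > 1/2`.
[folklore] -/
lemma differentiableAt_Fint (hRH : RiemannHypothesis) (hh : h ≠ 0) (hx : 0 < x) {s : ℂ}
    (hs : 1 / 2 < s.re) : DifferentiableAt ℂ (Fint h x) s := by
  have hs0 : s ≠ 0 := fun h0 => by rw [h0] at hs; norm_num at hs
  have hs1 : s + 1 ≠ 0 := fun h0 => by
    have := congrArg Complex.re h0; simp at this; linarith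
  have hopen : IsOpen {z : ℂ | 1 / 2 < z.re} := isOpen_lt continuous_const Complex.continuous_re
  have hζ : DifferentiableAt ℂ zetaInv s :=
    (differentiableOn_zetaInv hRH).differentiableAt (hopen.mem_nhds hs)
  have hxs : DifferentiableAt ℂ (fun z : ℂ => (x : ℂ) ^ z) s :=
    differentiableAt_id.const_cpow (Or.inl (by exact_mod_cast hx.ne'))
  unfold Fint
  exact ((differentiableAt_Phi h hs0 hs1 hh).mul hxs).mul hζ

/-- Under RH, `F_{h,x}` is holomorphic on `Re s > 1/2`. [folklore] -/
lemma differentiableOn_Fint (hRH : RiemannHypothesis) (hh : h ≠ 0) (hx : 0 < x) :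
    DifferentiableOn ℂ (Fint h x) {s : ℂ | 1 / 2 < s.re} :=
  fun _ hs => (differentiableAt_Fint hRH hh hx hs).differentiableWithinAt

/-- Continuity of `t ↦ F_{h,x}(σ + it)` for `σ > 1/2` (under RH). [folklore] -/
lemma continuous_Fint_vertical (hRH : RiemannHypothesis) (hh : h ≠ 0) (hx : 0 < x) {σ : ℝ}
    (hσ : 1 / 2 < σ) : Continuous fun t : ℝ => Fint h x (σ + t * I) :=
  (differentiableOn_Fint hRH hh hx).continuousOn.comp_continuous (by fun_prop)
    (fun t => by simpa using hσ)

/-- `Re (σ + it) = σ`. [folklore] -/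
lemma re_line (σ t : ℝ) : ((σ : ℂ) + t * I).re = σ := by simp

/-- `‖σ + it‖² = σ² + t²`. [folklore] -/
lemma sq_norm_line (σ t : ℝ) : ‖(σ : ℂ) + t * I‖ ^ 2 = σ ^ 2 + t ^ 2 := by
  rw [Complex.sq_norm, Complex.normSq_apply]; simp; ring

/-- Pointwise bound `‖F(σ+it)‖ ≤ ‖Φ_h(σ+it)‖ x^σ K (1+|t|)^ε` from a bound on `ζinv`. [folklore] -/
lemma norm_Fint_le (hx : 0 < x) {K ε σ₀ : ℝ}
    (hK : ∀ σ t : ℝ, σ₀ ≤ σ → ‖zetaInv (σ + t * I)‖ ≤ K * (1 + |t|) ^ ε) {σ : ℝ} (hσ : σ₀ ≤ σ)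
    (t : ℝ) : ‖Fint h x (σ + t * I)‖ ≤ ‖Phi h (σ + t * I)‖ * x ^ σ * (K * (1 + |t|) ^ ε) := by
  unfold Fint
  rw [norm_mul, norm_mul, Complex.norm_cpow_eq_rpow_re_of_pos hx, re_line]
  have h0 : 0 ≤ ‖Phi h (σ + t * I)‖ * x ^ σ := by positivity
  exact mul_le_mul_of_nonneg_left (hK σ t hσ) h0

/-- Integrability of `t ↦ F(σ+it)` (`1/2 < σ ≤ 2`, `σ₀ ≤ σ`, `ε < 1`). [folklore] -/
lemma integrable_Fint_vertical (hRH : RiemannHypothesis) (hh : 0 < h) (hh1 : h ≤ 1) (hx : 0 < x)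
    {K ε σ₀ : ℝ} (hK0 : 0 ≤ K) (hε1 : ε < 1)
    (hK : ∀ σ t : ℝ, σ₀ ≤ σ → ‖zetaInv (σ + t * I)‖ ≤ K * (1 + |t|) ^ ε) {σ : ℝ} (hσ₀ : σ₀ ≤ σ)
    (hσ : 1 / 2 < σ) (hσ2 : σ ≤ 2) : Integrable fun t : ℝ => Fint h x (σ + t * I) := by
  set C : ℝ := 9 / (h * min (σ ^ 2) 1) * 2 * x ^ σ * K with hC
  have hfin : (Module.finrank ℝ ℝ : ℝ) < 2 - ε := by simp; linarith
  refine Integrable.mono' ((integrable_one_add_norm hfin).const_mul C)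
    (continuous_Fint_vertical hRH hh.ne' hx hσ).aestronglyMeasurable
    (Eventually.of_forall fun t => ?_)
  refine (norm_Fint_le hx hK hσ₀ t).trans ?_
  have hΦ := norm_Phi_vertical_le hh hh1 (by linarith) hσ2 t
  have hu : 0 < 1 + |t| := by positivity
  have h2 : (1 + t ^ 2)⁻¹ ≤ 2 * (1 + |t|) ^ (-(2 : ℝ)) := by
    rw [Real.rpow_neg hu.le, show ((1 + |t|) ^ (2 : ℝ) : ℝ) = (1 + |t|) ^ 2 by norm_num,
      ← div_eq_mul_inv, le_div_iff₀ (by positivity)]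
    have : (1 + |t|) ^ 2 ≤ 2 * (1 + t ^ 2) := by
      have := sq_abs t; nlinarith [abs_nonneg t, sq_nonneg (|t| - 1)]
    calc (1 + t ^ 2)⁻¹ * (1 + |t|) ^ 2 ≤ (1 + t ^ 2)⁻¹ * (2 * (1 + t ^ 2)) := by gcongr
      _ = 2 := by field_simp
  have hm : 0 < min (σ ^ 2) 1 := lt_min (by positivity) one_pos
  calc ‖Phi h (σ + t * I)‖ * x ^ σ * (K * (1 + |t|) ^ ε)
      ≤ (9 / (h * min (σ ^ 2) 1) * (1 + t ^ 2)⁻¹) * x ^ σ * (K * (1 + |t|) ^ ε) := by gcongr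
    _ ≤ (9 / (h * min (σ ^ 2) 1) * (2 * (1 + |t|) ^ (-(2 : ℝ)))) * x ^ σ * (K * (1 + |t|) ^ ε) := by
        gcongr
    _ = C * ((1 + |t|) ^ (-(2 : ℝ)) * (1 + |t|) ^ ε) := by rw [hC]; ring
    _ = C * (1 + ‖t‖) ^ (-(2 - ε)) := by
        rw [← Real.rpow_add hu, Real.norm_eq_abs]; congr 1; ring_nf

/-- Uniform decay on horizontal segments: `‖F(σ + iT)‖ ≤ 18 x² K/(h|T|)` for `σ ∈ [σ₀, 2]`,
`|T| ≥ 1`, `x ≥ 1`. [folklore] -/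
lemma decay_Fint (hh : 0 < h) (hh1 : h ≤ 1) (hx : 1 ≤ x) {K ε σ₀ : ℝ} (hK0 : 0 ≤ K)
    (hε1 : ε ≤ 1)
    (hK : ∀ σ t : ℝ, σ₀ ≤ σ → ‖zetaInv (σ + t * I)‖ ≤ K * (1 + |t|) ^ ε) (hσ₀ : 0 < σ₀)
    {ε₀ : ℝ} (hε₀ : 0 < ε₀) :
    ∃ T₀ : ℝ, ∀ σ ∈ Icc σ₀ 2, ∀ T : ℝ, T₀ ≤ |T| → ‖Fint h x (σ + T * I)‖ ≤ ε₀ := by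
  refine ⟨max 1 (18 * x ^ 2 * K / (h * ε₀)), fun σ hσ T hT => ?_⟩
  have hT1 : 1 ≤ |T| := le_of_max_le_left hT
  have hT2 : 18 * x ^ 2 * K / (h * ε₀) ≤ |T| := le_of_max_le_right hT
  have hTpos : 0 < |T| := by linarith
  have hσ0 : 0 < σ := by linarith [hσ.1]
  have hx0 : 0 < x := by linarith
  refine (norm_Fint_le hx0 hK hσ.1 T).trans ?_
  have hΦ := norm_Phi_le_sq hh hh1 (s := σ + T * I) (by rw [re_line]; exact hσ0)
    (by rw [re_line]; exact hσ.2)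
  rw [sq_norm_line] at hΦ
  have hxσ : x ^ σ ≤ x ^ 2 := by
    calc x ^ σ ≤ x ^ (2 : ℝ) := Real.rpow_le_rpow_of_exponent_le hx hσ.2
      _ = x ^ 2 := by norm_num
  have hpow : (1 + |T|) ^ ε ≤ 2 * |T| := by
    calc (1 + |T|) ^ ε ≤ (1 + |T|) ^ (1 : ℝ) :=
          Real.rpow_le_rpow_of_exponent_le (by linarith) hε1
      _ = 1 + |T| := Real.rpow_one _
      _ ≤ 2 * |T| := by linarith
  have hst : h * T ^ 2 ≤ h * (σ ^ 2 + T ^ 2) := by gcongr; nlinarith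
  have hT0 : 0 < T ^ 2 := by have := pow_pos hTpos 2; rwa [sq_abs] at this
  have hhT : 0 < h * T ^ 2 := mul_pos hh hT0
  calc ‖Phi h (σ + T * I)‖ * x ^ σ * (K * (1 + |T|) ^ ε)
      ≤ (9 / (h * (σ ^ 2 + T ^ 2))) * x ^ 2 * (K * (2 * |T|)) := by gcongr
    _ ≤ (9 / (h * T ^ 2)) * x ^ 2 * (K * (2 * |T|)) := by gcongr
    _ = 18 * x ^ 2 * K / (h * |T|) := by
        rw [← sq_abs T]; field_simp; ring
    _ ≤ ε₀ := by
        rw [div_le_iff₀ (by positivity)]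
        rw [div_le_iff₀ (by positivity)] at hT2
        nlinarith

/-- **The vertical integral at `Re s = 2` equals the smoothed sum**:
`∫ F_{h,x}(2+it) dt = 2π ∑' μ(n) φ_h(n/x)`. [folklore] -/
theorem integral_Fint_two (hh : 0 < h) (hh1 : h ≤ 1) (hx : 0 < x) :
    ∫ t : ℝ, Fint h x (2 + t * I) =
      2 * π * ∑' n : ℕ, (ArithmeticFunction.moebius n : ℂ) * (phi h (n / x) : ℂ) := by
  have key := integral_vertical_two_eq_tsum (Phi h) (fun y => (phi h y : ℂ))
    (integrable_Phi_vertical hh hh1 two_pos le_rfl)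
    (fun y hy => mellinInv_Phi hh hh1 two_pos le_rfl hy) hx
  rw [← key]
  refine integral_congr_ae (Eventually.of_forall fun t => ?_)
  have hne : (2 : ℂ) + t * I ≠ 1 := by
    intro h0; have := congrArg Complex.re h0; simp at this
  simp only [Fint, zetaInv_of_ne_one hne]

/-- **Line shift** for `F_{h,x}` from `Re s = 2` to `Re s = c'` (`1/2 < c' ≤ 2`), under RH and a
uniform bound `‖ζinv(σ+it)‖ ≤ K(1+|t|)^ε` on `σ ≥ c'` (`ε < 1`). [folklore] -/
theorem integral_Fint_eq_two (hRH : RiemannHypothesis) (hh : 0 < h) (hh1 : h ≤ 1) (hx : 1 ≤ x)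
    {K ε c' : ℝ} (hK0 : 0 ≤ K) (hε1 : ε < 1) (hc' : 1 / 2 < c') (hc'2 : c' ≤ 2)
    (hK : ∀ σ t : ℝ, c' ≤ σ → ‖zetaInv (σ + t * I)‖ ≤ K * (1 + |t|) ^ ε) :
    ∫ t : ℝ, Fint h x (c' + t * I) = ∫ t : ℝ, Fint h x (2 + t * I) := by
  have hx0 : 0 < x := by linarith
  have h2 : ((2 : ℝ) : ℂ) = 2 := by norm_num
  have := integral_vertical_eq_of_tendsto (Fint h x) hc'2 ?_
    (integrable_Fint_vertical hRH hh hh1 hx0 hK0 hε1 hK le_rfl hc' hc'2)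
    (by simpa only [h2] using
      integrable_Fint_vertical hRH hh hh1 hx0 hK0 hε1 hK hc'2 (by norm_num) le_rfl)
    (fun ε₀ hε₀ => decay_Fint hh hh1 hx hK0 hε1.le hK (by linarith) hε₀)
  · simpa only [h2] using this
  · refine (differentiableOn_Fint hRH hh.ne' hx0).mono fun z hz => ?_
    rw [mem_reProdIm] at hz
    simp only [Set.mem_setOf_eq]
    linarith [hz.1.1]

/-- **Bound on the shifted integral**: on `Re s = c'` (`1/2 < c' ≤ 1`),
`‖∫ F_{h,x}(c'+it) dt‖ ≤ 9 (2/c')² K J_ε · x^{c'} h^{-2ε}` with `J_ε = ∫ (1+|t|)^{-1-ε} dt`.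
[folklore] -/
theorem norm_integral_Fint_le (hh : 0 < h) (hh1 : h ≤ 1) (hx : 0 < x) {K ε c' : ℝ} (hK0 : 0 ≤ K)
    (hε : 0 < ε) (hε2 : ε ≤ 1 / 2) (hc' : 1 / 2 < c') (hc'1 : c' ≤ 1)
    (hK : ∀ σ t : ℝ, c' ≤ σ → ‖zetaInv (σ + t * I)‖ ≤ K * (1 + |t|) ^ ε) :
    ‖∫ t : ℝ, Fint h x (c' + t * I)‖ ≤
      (9 * (2 / c') ^ 2 * K * ∫ t : ℝ, (1 + ‖t‖) ^ (-(1 + ε))) * x ^ c' * h ^ (-(2 * ε)) := by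
  set C₀ : ℝ := 9 * (2 / c') ^ 2 * K * x ^ c' * h ^ (-(2 * ε)) with hC₀
  have hfin : (Module.finrank ℝ ℝ : ℝ) < 1 + ε := by simp; linarith
  have hint : Integrable fun t : ℝ => C₀ * (1 + ‖t‖) ^ (-(1 + ε)) :=
    (integrable_one_add_norm hfin).const_mul C₀
  refine (norm_integral_le_of_norm_le hint (Eventually.of_forall fun t => ?_)).trans (le_of_eq ?_)
  · refine (norm_Fint_le hx hK le_rfl t).trans ?_
    set s : ℂ := c' + t * I with hs
    have hsre : s.re = c' := re_line c' t
    have hΦ := norm_Phi_le_rpow hh hh1 (s := s) (by rw [hsre]; linarith) (by rw [hsre]; linarith)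
      hε hε2
    have hu : 0 < 1 + |t| := by positivity
    have hsn : c' / 2 * (1 + |t|) ≤ ‖s‖ := by
      have h1 : 0 ≤ c' / 2 * (1 + |t|) := by positivity
      rw [← Real.sqrt_sq h1, ← Real.sqrt_sq (norm_nonneg s), hs, sq_norm_line]
      refine Real.sqrt_le_sqrt ?_
      have h2 := sq_abs t
      have h3 : c' ^ 2 ≤ 1 := by nlinarith
      have h4 : 0 ≤ c' ^ 2 * (|t| - 1) ^ 2 := by positivity
      have h5 : 0 ≤ t ^ 2 * (1 - c' ^ 2) := mul_nonneg (sq_nonneg t) (by linarith)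
      nlinarith [abs_nonneg t]
    have hspow : ‖s‖ ^ (-(1 + 2 * ε)) ≤ (2 / c') ^ 2 * (1 + |t|) ^ (-(1 + 2 * ε)) := by
      calc ‖s‖ ^ (-(1 + 2 * ε)) ≤ (c' / 2 * (1 + |t|)) ^ (-(1 + 2 * ε)) :=
            Real.rpow_le_rpow_of_nonpos (by positivity) hsn (by linarith)
        _ = (c' / 2) ^ (-(1 + 2 * ε)) * (1 + |t|) ^ (-(1 + 2 * ε)) :=
            Real.mul_rpow (by positivity) hu.le
        _ ≤ (2 / c') ^ 2 * (1 + |t|) ^ (-(1 + 2 * ε)) := by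
            gcongr
            rw [Real.rpow_neg (by positivity), ← Real.inv_rpow (by positivity), inv_div]
            calc (2 / c') ^ (1 + 2 * ε) ≤ (2 / c') ^ (2 : ℝ) :=
                  Real.rpow_le_rpow_of_exponent_le (by rw [le_div_iff₀ (by linarith)]; linarith)
                    (by linarith)
              _ = (2 / c') ^ 2 := by norm_num
    calc ‖Phi h s‖ * x ^ c' * (K * (1 + |t|) ^ ε)
        ≤ (9 * h ^ (-(2 * ε)) * ‖s‖ ^ (-(1 + 2 * ε))) * x ^ c' * (K * (1 + |t|) ^ ε) := by gcongr
      _ ≤ (9 * h ^ (-(2 * ε)) * ((2 / c') ^ 2 * (1 + |t|) ^ (-(1 + 2 * ε)))) * x ^ c' *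
            (K * (1 + |t|) ^ ε) := by gcongr
      _ = C₀ * ((1 + |t|) ^ (-(1 + 2 * ε)) * (1 + |t|) ^ ε) := by rw [hC₀]; ring
      _ = C₀ * (1 + ‖t‖) ^ (-(1 + ε)) := by
          rw [← Real.rpow_add hu, Real.norm_eq_abs]; congr 1; ring_nf
  · rw [integral_const_mul, hC₀]; ring

/-- The smoothed sum is a finite sum (`φ_h(n/x) = 0` for `n > x(1+h)`). [folklore] -/
lemma tsum_moebius_phi_eq_sum (hh : 0 < h) (hx : 0 < x) :
    ∑' n : ℕ, (ArithmeticFunction.moebius n : ℂ) * (phi h (n / x) : ℂ) =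
      ∑ n ∈ Finset.range (⌊x * (1 + h)⌋₊ + 1),
        (ArithmeticFunction.moebius n : ℂ) * (phi h (n / x) : ℂ) := by
  refine tsum_eq_sum fun n hn => ?_
  simp only [Finset.mem_range, not_lt] at hn
  have h1 : x * (1 + h) < n := (Nat.floor_lt (by positivity)).mp hn
  have h2 : 1 + h ≤ n / x := by rw [le_div_iff₀ hx]; linarith
  simp [phi_of_ge hh h2]

/-- `M(x)` as a smoothed sum with the weights `φ_h(n/x) = 1` for `n ≤ x`. [folklore] -/
lemma mertensFunction_eq_sum_phi (hh : 0 < h) (hx : 0 < x) :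
    (LFunctions.mertensFunction x : ℂ) =
      ∑ n ∈ Finset.range (⌊x⌋₊ + 1), (ArithmeticFunction.moebius n : ℂ) * (phi h (n / x) : ℂ) := by
  have hI : Finset.range (⌊x⌋₊ + 1) = insert 0 (Finset.Ioc 0 ⌊x⌋₊) := by
    ext n; simp only [Finset.mem_range, Finset.mem_insert, Finset.mem_Ioc]; omega
  rw [hI, Finset.sum_insert (by simp), LFunctions.mertensFunction]
  simp only [ArithmeticFunction.map_zero, Int.cast_zero, zero_mul, zero_add, Int.cast_sum]
  refine Finset.sum_congr rfl fun n hn => ?_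
  rw [Finset.mem_Ioc] at hn
  have : (n : ℝ) / x ≤ 1 := by
    rw [div_le_one hx]
    exact (Nat.cast_le.mpr hn.2).trans (Nat.floor_le hx.le)
  rw [phi_of_le_one hh this]
  simp

/-- `|M(x) − ∑ μ(n) φ_h(n/x)| ≤ x h + 1` (the weights differ only for `x < n ≤ x(1+h)`).
[folklore] -/
lemma norm_mertens_sub_tsum_le (hh : 0 < h) (hx : 1 ≤ x) :
    ‖(LFunctions.mertensFunction x : ℂ) -
        ∑' n : ℕ, (ArithmeticFunction.moebius n : ℂ) * (phi h (n / x) : ℂ)‖ ≤ x * h + 1 := by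
  have hx0 : 0 < x := by linarith
  rw [tsum_moebius_phi_eq_sum hh hx0, mertensFunction_eq_sum_phi hh hx0]
  set N₁ : ℕ := ⌊x⌋₊ + 1
  set N₂ : ℕ := ⌊x * (1 + h)⌋₊ + 1
  have hN : N₁ ≤ N₂ := by
    apply Nat.succ_le_succ
    exact Nat.floor_le_floor (by nlinarith)
  rw [Finset.range_eq_Ico, Finset.range_eq_Ico, ← Finset.sum_Ico_consecutive _ (Nat.zero_le N₁) hN,
    sub_add_cancel_left, norm_neg]
  calc ‖∑ n ∈ Finset.Ico N₁ N₂, (ArithmeticFunction.moebius n : ℂ) * (phi h (n / x) : ℂ)‖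
      ≤ ∑ n ∈ Finset.Ico N₁ N₂, ‖(ArithmeticFunction.moebius n : ℂ) * (phi h (n / x) : ℂ)‖ :=
        norm_sum_le _ _
    _ ≤ ∑ n ∈ Finset.Ico N₁ N₂, (1 : ℝ) := Finset.sum_le_sum fun n _ => by
        rw [norm_mul, Complex.norm_intCast, Complex.norm_real, Real.norm_eq_abs]
        have h1 : |(ArithmeticFunction.moebius n : ℝ)| ≤ 1 := by
          exact_mod_cast ArithmeticFunction.abs_moebius_le_one
        have h2 := abs_phi_le_one h (n / x)
        nlinarith [abs_nonneg (ArithmeticFunction.moebius n : ℝ), abs_nonneg (phi h (n / x))]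
    _ = (N₂ - N₁ : ℕ) := by simp
    _ = (⌊x * (1 + h)⌋₊ : ℝ) - ⌊x⌋₊ := by
        rw [Nat.cast_sub hN]; simp [N₁, N₂]
    _ ≤ x * (1 + h) - (x - 1) := by
        gcongr
        · exact Nat.floor_le (by positivity)
        · linarith [Nat.lt_floor_add_one x]
    _ = x * h + 1 := by ring

/-- **RH ⇒ `M(x) = O(x^{1/2+ε})`** (Titchmarsh 1986, Thm. 14.25 (A) ⇒ (C), §14.25: Perron's
formula for `1/ζ`, contour moved to `Re w = 1/2 + δ`, "by (14.2.6). Taking `T = x²`, (14.25.2)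
follows"). Proof here: smoothed Perron formula `∑ μ(n)φ_h(n/x) = (1/2πi)∫_{(2)} Φ_h(s) x^s/ζ(s) ds`,
line shift to `Re s = 1/2 + ε'` using Littlewood's bound (14.2.6) (`exists_bound_zetaInv`,
from `RHInvZetaBound.lean`), the bound `‖Φ_h‖ ≤ 9h^{-2ε'}|s|^{-1-2ε'}`, and `h = x^{-1/2}`.
[cite: Titchmarsh1986, Thm 14.25 ((A) ⇒ (C))] -/
theorem mertens_isBigO_of_riemannHypothesis
    (hRH : RiemannHypothesis) {ε : ℝ} (hε : 0 < ε) :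
    (fun x : ℝ => (LFunctions.mertensFunction x : ℝ)) =O[atTop] fun x : ℝ => x ^ (1 / 2 + ε) := by
  -- parameters
  set ε' : ℝ := min (ε / 2) (1 / 4) with hε'
  have hε'0 : 0 < ε' := lt_min (by linarith) (by norm_num)
  have hε'1 : ε' ≤ 1 / 4 := min_le_right _ _
  have hε'2 : ε' ≤ ε / 2 := min_le_left _ _
  set c' : ℝ := 1 / 2 + ε' with hc'
  obtain ⟨K, hK0, hK⟩ := exists_bound_zetaInv hRH (σ₀ := c') (by linarith) hε'0
  set J : ℝ := ∫ t : ℝ, (1 + ‖t‖) ^ (-(1 + ε')) with hJ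
  set C₁ : ℝ := 9 * (2 / c') ^ 2 * K * J with hC₁
  have hJ0 : 0 ≤ J := integral_nonneg fun t => by positivity
  have hC₁0 : 0 ≤ C₁ := by positivity
  refine IsBigO.of_bound (2 + C₁) ?_
  filter_upwards [eventually_ge_atTop (1 : ℝ)] with x hx
  have hx0 : 0 < x := by linarith
  -- the cutoff width
  set h : ℝ := x ^ (-(1 / 2 : ℝ)) with hhdef
  have hh : 0 < h := Real.rpow_pos_of_pos hx0 _
  have hh1 : h ≤ 1 := by
    rw [hhdef, Real.rpow_neg hx0.le]
    exact inv_le_one_of_one_le₀ (Real.one_le_rpow hx (by norm_num))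
  -- the smoothed sum and its integral representation
  set S : ℂ := ∑' n : ℕ, (ArithmeticFunction.moebius n : ℂ) * (phi h (n / x) : ℂ) with hS
  have hV2 : ∫ t : ℝ, Fint h x (2 + t * I) = 2 * π * S := integral_Fint_two hh hh1 hx0
  have hshift := integral_Fint_eq_two hRH hh hh1 hx hK0.le (by linarith) (by linarith)
    (by linarith) hK
  have hbound := norm_integral_Fint_le hh hh1 hx0 hK0.le hε'0 (by linarith) (by linarith)
    (by linarith) hK
  rw [hshift, hV2, ← hJ, ← hC₁] at hbound
  -- `‖S‖ ≤ C₁ x^{c'} h^{-2ε'} / (2π) ≤ C₁ x^{c'+ε'}`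
  have hhpow : h ^ (-(2 * ε')) = x ^ ε' := by
    rw [hhdef, ← Real.rpow_mul hx0.le]; congr 1; ring
  have hxc : x ^ c' * x ^ ε' = x ^ (c' + ε') := (Real.rpow_add hx0 _ _).symm
  have hS_le : ‖S‖ ≤ C₁ * x ^ (c' + ε') := by
    rw [norm_mul, show ‖(2 * π : ℂ)‖ = 2 * π by
      rw [norm_mul, Complex.norm_ofNat, Complex.norm_real, Real.norm_eq_abs,
        abs_of_pos Real.pi_pos]]
      at hbound
    rw [hhpow, mul_assoc C₁, hxc] at hbound
    have h2π : (1 : ℝ) ≤ 2 * π := by linarith [Real.pi_gt_three]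
    have : ‖S‖ ≤ 2 * π * ‖S‖ := le_mul_of_one_le_left (norm_nonneg _) h2π
    exact this.trans hbound
  -- combine with `‖M(x) − S‖ ≤ x h + 1 = √x + 1`
  have hMS := norm_mertens_sub_tsum_le hh hx
  have hxh : x * h = x ^ (1 / 2 : ℝ) := by
    rw [hhdef, Real.rpow_neg hx0.le]
    rw [show x * (x ^ (1 / 2 : ℝ))⁻¹ = x ^ (1 : ℝ) / x ^ (1 / 2 : ℝ) by rw [Real.rpow_one]; ring,
      ← Real.rpow_sub hx0]
    norm_num
  have hexp : c' + ε' ≤ 1 / 2 + ε := by rw [hc']; linarith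
  have hx1 : (1 : ℝ) ≤ x ^ (1 / 2 + ε) := Real.one_le_rpow hx (by linarith)
  have hx2 : x ^ (1 / 2 : ℝ) ≤ x ^ (1 / 2 + ε) := Real.rpow_le_rpow_of_exponent_le hx (by linarith)
  have hx3 : x ^ (c' + ε') ≤ x ^ (1 / 2 + ε) := Real.rpow_le_rpow_of_exponent_le hx hexp
  rw [Real.norm_eq_abs, Real.norm_eq_abs, abs_of_nonneg (by positivity : (0 : ℝ) ≤ x ^ (1 / 2 + ε))]
  have hM : |(LFunctions.mertensFunction x : ℝ)| = ‖(LFunctions.mertensFunction x : ℂ)‖ := by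
    rw [Complex.norm_intCast]
  rw [hM]
  calc ‖((LFunctions.mertensFunction x : ℤ) : ℂ)‖
      ≤ ‖(LFunctions.mertensFunction x : ℂ) - S‖ + ‖S‖ := norm_le_norm_sub_add _ _
    _ ≤ (x * h + 1) + C₁ * x ^ (c' + ε') := add_le_add hMS hS_le
    _ = x ^ (1 / 2 : ℝ) + 1 + C₁ * x ^ (c' + ε') := by rw [hxh]
    _ ≤ x ^ (1 / 2 + ε) + x ^ (1 / 2 + ε) + C₁ * x ^ (1 / 2 + ε) := by gcongr
    _ = (2 + C₁) * x ^ (1 / 2 + ε) := by ring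

end MertensBoundRH

/-- The `θ = 1/2` case of the named fact `mertens_isBigO_of_quasiRiemannHypothesis`
(`QuasiRHFacts.lean`), proved: `QuasiRiemannHypothesis (1/2)` is RH
(`quasiRiemannHypothesis_one_half_iff_holds`), so `M(x) = O(x^{1/2+ε})` for every `ε > 0` by
`MertensBoundRH.mertens_isBigO_of_riemannHypothesis`. (The general-`θ` fact needs the analogue
of (14.2.6) under a zero-free half-plane `σ > θ`, which is not in the tree.)
[cite: Titchmarsh1986, Thm 14.25 ((A) ⇒ (C))] -/
theorem mertens_isBigO_of_quasiRiemannHypothesis_one_half (hQ : QuasiRiemannHypothesis (1 / 2))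
    {ε : ℝ} (hε : 0 < ε) :
    (fun x : ℝ => (LFunctions.mertensFunction x : ℝ)) =O[atTop] fun x : ℝ => x ^ (1 / 2 + ε) :=
  MertensBoundRH.mertens_isBigO_of_riemannHypothesis
    (quasiRiemannHypothesis_one_half_iff_holds.mp hQ) hε

section RH

/-- **RH ⇒ `M(x) = O(x^{1/2+ε})`** (Littlewood 1912; Titchmarsh 1986, Thm. 14.25 (A) ⇒ (C)),
proved: smoothed Perron formula + line shift (this file) and Littlewood's bound (14.2.6)
(`RHInvZetaBound.lean`). [cite: Titchmarsh1986, Thm 14.25 ((A) ⇒ (C))] -/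
theorem mertensFunction_isBigO_of_riemannHypothesis (hRH : RiemannHypothesis) {ε : ℝ}
    (hε : 0 < ε) :
    (fun x : ℝ => (mertensFunction x : ℝ)) =O[atTop] fun x : ℝ => x ^ (1 / 2 + ε) :=
  MertensBoundRH.mertens_isBigO_of_riemannHypothesis hRH hε

/-- **Discharge of rh.S21, Littlewood's criterion** (J. E. Littlewood, C. R. Acad. Sci. Paris 154
(1912), 263–266; Titchmarsh 1986, Thm. 14.25 (C), §14.25: "A necessary and sufficient
condition for the Riemann hypothesis is `M(x) = O(x^{1/2+ε})`"): the named fact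
`riemannHypothesis_iff_mertensFunction_isBigO` of `RHClassicalEquivalents.lean` holds. Necessity:
`mertensFunction_isBigO_of_riemannHypothesis` (Perron + (14.2.6)); sufficiency:
`riemannHypothesis_of_mertensFunction_isBigO` (`LittlewoodCriterion.lean`, partial summation and
analytic continuation of `∑ μ(n) n^{-s}`).
[cite: Littlewood1912, Théorème (Titchmarsh Thm 14.25 C)] -/
theorem riemannHypothesis_iff_mertensFunction_isBigO_holds :
    riemannHypothesis_iff_mertensFunction_isBigO :=
  ⟨fun hRH _ε hε => mertensFunction_isBigO_of_riemannHypothesis hRH hε,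
    riemannHypothesis_of_mertensFunction_isBigO⟩

end RH

end Literature.NumberTheory.LFunctions

end
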